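import Mathlib
import Summits.Ventures.HodgeRepro2.T5GaussianField
import Summits.Ventures.HodgeRepro2.T5GaussianPlace
import Summits.Ventures.HodgeRepro2.T5ConcretePlaces
import Summits.Ventures.HodgeRepro2.T5CompletionDegreeSum
import Summits.Ventures.HodgeRepro2.T6N5LocalSignModelGlobal
import Summits.Ventures.HodgeRepro2.T6N5LocalRamWitness
import Summits.Ventures.HodgeRepro2.T6N5LocalInertWitness

/-!
# T6N5LocalSignModelGlobalWitness — Tier 6, M2 sub-step N5 (t6-p8's half): THE §10.5(ii)(c),(d) WITNESS of
`T6N5LocalSignModelGlobal` — the host-shaped statement `exists_signModel_ofGlobal` instantiated on `ℚ ⊆ ℚ(ζ₄)` with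
the toy three data at EVERY finite non-split place (inert or ramified, by the place-data dichotomy) and t6-p7's toy
real data at the real place, every hypothesis discharged

* `toyInputInert Q` / `toyInputRam Q` — the local input with the toy ε-factor parameter, the toy `ψ_δ` (the
  normalised `ψ₁` at an inert place; the character of `exists_psi_trivial_on_base` at a ramified place) and the toy
  Weil representation of the gen-6 witnesses, at ANY inert / ramified place; `toyInputInert_hyps` /
  `toyInputRam_hyps` — their `Hyps` hold (the gen-6 display theorems `hT_toy` / `hG_toy` / `hT6_toy` / `h35_toy`,
  the two smoothness facts, `ϵ_δ(W) = 1`, `hχW_toy`);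
* `toyThreeData pd` — the three data by the kind of the place data; `ofUnique_toyThreeData` — the local input
  `ofUnique` with them IS `toyInput` at the chosen place data; `toyFamily` — the toy three data at every non-split
  finite place of `ℚ` in `ℚ(ζ₄)`; `toyFamily_hyps`;
* `isNonSplit_v₂` — `2` is non-split in `ℚ(ζ₄)` (p4's `T5ConcretePlaces.wild` + `T5GaussianPlace.finrank_eq_two` +
  the quadratic dictionary `unique_of_finrank_eq_two`), so the family has a finite non-split place (`kindOf_v₂`);
  `exists_real_place_rat` / `exists_kindOf_eq_re` — `ℚ` has a real place, so the real-place clause is not vacuous;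
* `gaussian_global_witness` — THE WITNESS: a sign model on the places of `ℚ` with the global kinds, the statements
  of record's local data at every non-split place, `Solves ∧ RealCondB`.
README §8(d): uses an L-value-free non-vanishing device: NO.
-/

namespace Summit.Ventures.HodgeRepro2.T6.N5LocalSignModelGlobalWitness

open Summit.Ventures.HodgeRepro2 IsDedekindDomain HeightOneSpectrum
  Summit.Ventures.HodgeRepro2.T6.N5LocalDatum Summit.Ventures.HodgeRepro2.T6.N5Local
  Summit.Ventures.HodgeRepro2.T6.N5LocalTateChars Summit.Ventures.HodgeRepro2.T6.N5LocalWeilQuotient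
  Summit.Ventures.HodgeRepro2.T6.N5LocalQuotientToy Summit.Ventures.HodgeRepro2.T6.N5LocalRamToyEps
  Summit.Ventures.HodgeRepro2.T6.N5LocalInertToyEps Summit.Ventures.HodgeRepro2.T6.N5LocalRamCompletion
  Summit.Ventures.HodgeRepro2.T6.N5LocalInertCompletion Summit.Ventures.HodgeRepro2.T6.N5Rich
  Summit.Ventures.HodgeRepro2.T6.N5RealPlace Summit.Ventures.HodgeRepro2.T6.N5LocalSignModel
  Summit.Ventures.HodgeRepro2.T6.N5LocalSignModelGlobal

noncomputable section

/-! ### The toy local input at any inert or ramified place -/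

section Toy

variable {K : Type} [Field K] [NumberField K] (v : HeightOneSpectrum (NumberField.RingOfIntegers K))
  {L : Type} [Field L] [NumberField L] [Algebra K L] (w : HeightOneSpectrum (NumberField.RingOfIntegers L))
  [w.asIdeal.LiesOver v.asIdeal]

/-- The toy local input at an inert place: the toy parameter, `ψ_δ := ψ₁`, the toy Weil representation. -/
def toyInputInert (Q : InertPlace v w) : LocalInput v w where
  place := Sum.inl Q
  P := Q.toyP
  ψδ := Q.ψ₁
  hK := Q.ψ₁_algebraMap
  R := N5LocalInertWitness.weilT Q
  nontriv := nontrivial_wsp v w (U v w Q.ϖ) (N5LocalInertWitness.sgnT Q) (N5LocalInertWitness.good_nonempty Q)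

/-- Every hypothesis of the inert statement of record v2 holds on the toy input. -/
theorem toyInputInert_hyps (Q : InertPlace v w) : (toyInputInert v w Q).Hyps := by
  show (toyInputInert v w Q).InertHyps Q
  exact ⟨Q.hG_toy, Q.hT_toy, N5LocalInertWitness.h35_toy Q,
    fun s => isSmoothCompact v w (U v w Q.ϖ) (N5LocalInertWitness.sgnT Q)
      (N5LocalInertWitness.finiteIndex_Fsub_sup_U Q) s,
    fun s => isSmoothOpen v w (U v w Q.ϖ) (N5LocalInertWitness.sgnT Q) (U_antitone v w Q.ϖ) s,
    rfl, N5LocalInertWitness.hχW_toy Q⟩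

/-- The datum's `ψ_δ` at a ramified place, chosen (`exists_psi_trivial_on_base`). -/
def ψδRam (Q : RamPlace v w) : PsiC w :=
  (N5LocalRamWitness.exists_psi_trivial_on_base Q.h2 Q.σ Q.hσ).choose

/-- … trivial on `K_v`. -/
theorem ψδRam_algebraMap (Q : RamPlace v w) (a : v.adicCompletion K) :
    (ψδRam v w Q).1 (algebraMap (v.adicCompletion K) (w.adicCompletion L) a) = 1 :=
  (N5LocalRamWitness.exists_psi_trivial_on_base Q.h2 Q.σ Q.hσ).choose_spec a

/-- The toy local input at a ramified place: the toy parameter, the chosen `ψ_δ`, the toy Weil representation. -/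
def toyInputRam (Q : RamPlace v w) : LocalInput v w where
  place := Sum.inr Q
  P := Q.toyP
  ψδ := ψδRam v w Q
  hK := ψδRam_algebraMap v w Q
  R := N5LocalRamWitness.weilT Q (ψδRam v w Q)
  nontriv := nontrivial_wsp v w (Uπ w Q.π) (N5LocalRamWitness.sgnT Q (ψδRam v w Q))
    (N5LocalRamWitness.good_nonempty Q (ψδRam v w Q) (ψδRam_algebraMap v w Q))

/-- Every hypothesis of the ramified statement of record v2 holds on the toy input. -/
theorem toyInputRam_hyps (Q : RamPlace v w) : (toyInputRam v w Q).Hyps := by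
  show (toyInputRam v w Q).RamHyps Q
  exact ⟨Q.hT6_toy (ψδRam v w Q), Q.hG_toy (ψδRam v w Q), N5LocalRamWitness.h35_toy Q (ψδRam v w Q),
    fun s => isSmoothCompact v w (Uπ w Q.π) (N5LocalRamWitness.sgnT Q (ψδRam v w Q))
      (N5LocalRamWitness.finiteIndex_Fsub_sup_Uπ Q) s,
    fun s => isSmoothOpen v w (Uπ w Q.π) (N5LocalRamWitness.sgnT Q (ψδRam v w Q)) (Uπ_antitone w Q.π) s,
    rfl, N5LocalRamWitness.hχW_toy Q (ψδRam v w Q)⟩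

/-- The toy local input by the kind of the place data. -/
def toyInput (pd : InertPlace v w ⊕ RamPlace v w) : LocalInput v w :=
  Sum.elim (toyInputInert v w) (toyInputRam v w) pd

/-- Its hypotheses hold for either kind. -/
theorem toyInput_hyps (pd : InertPlace v w ⊕ RamPlace v w) : (toyInput v w pd).Hyps := by
  rcases pd with Q | Q
  · exact toyInputInert_hyps v w Q
  · exact toyInputRam_hyps v w Q

/-- The toy three data by the kind of the place data. -/
def toyThreeData (pd : InertPlace v w ⊕ RamPlace v w) : ThreeData v w :=
  Sum.elim (fun Q => ⟨(toyInputInert v w Q).P, (toyInputInert v w Q).ψδ, (toyInputInert v w Q).hK,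
    (toyInputInert v w Q).R, (toyInputInert v w Q).nontriv⟩)
    (fun Q => ⟨(toyInputRam v w Q).P, (toyInputRam v w Q).ψδ, (toyInputRam v w Q).hK,
      (toyInputRam v w Q).R, (toyInputRam v w Q).nontriv⟩) pd

/-- The local input `ofUnique` with the toy three data at the chosen place data IS the toy input there. -/
theorem ofUnique_toyThreeData (hKL : Module.finrank K L = 2)
    (huniq : ∀ w' : HeightOneSpectrum (NumberField.RingOfIntegers L), w'.asIdeal.LiesOver v.asIdeal → w' = w) :
    LocalInput.ofUnique v w hKL huniq (toyThreeData v w (placeData v w hKL huniq)) =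
      toyInput v w (placeData v w hKL huniq) := by
  unfold LocalInput.ofUnique
  generalize placeData v w hKL huniq = pd
  rcases pd with Q | Q <;> rfl

/-- The hypotheses hold on the local input `ofUnique` with the toy three data. -/
theorem ofUnique_toyThreeData_hyps (hKL : Module.finrank K L = 2)
    (huniq : ∀ w' : HeightOneSpectrum (NumberField.RingOfIntegers L), w'.asIdeal.LiesOver v.asIdeal → w' = w) :
    (LocalInput.ofUnique v w hKL huniq (toyThreeData v w (placeData v w hKL huniq))).Hyps := by
  rw [ofUnique_toyThreeData]
  exact toyInput_hyps v w _

end Toy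

/-! ### The witness on `ℚ ⊆ ℚ(ζ₄)` -/

section Gaussian

open T5GaussianField

/-- THE TOY THREE DATA AT EVERY NON-SPLIT FINITE PLACE of `ℚ` in `ℚ(ζ₄)`. -/
def toyFamily : ThreeDataFamily ℚ L :=
  fun v h => toyThreeData v (placeAbove h) (placeData v (placeAbove h) finrank_eq_two (placeAbove_unique h))

/-- The per-place hypotheses hold on the toy family at every non-split finite place. -/
theorem toyFamily_hyps (v : HeightOneSpectrum (NumberField.RingOfIntegers ℚ)) (h : IsNonSplit ℚ L v) :
    (localInputAt finrank_eq_two toyFamily h).Hyps :=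
  ofUnique_toyThreeData_hyps v (placeAbove h) finrank_eq_two (placeAbove_unique h)

/-- `2` IS NON-SPLIT in `ℚ(ζ₄)`: a place above it exists (p4's `T5ConcretePlaces.wild`) and, its completion having
degree `2` (p4's `T5GaussianPlace.finrank_eq_two`), it is the only one (the quadratic dictionary). -/
theorem isNonSplit_v₂ : IsNonSplit ℚ L v₂ := by
  obtain ⟨w, hw⟩ := T5ConcretePlaces.wild.1
  haveI := hw
  exact ⟨w, hw, fun w' hw' =>
    T5CompletionDegreeSum.unique_of_finrank_eq_two v₂ finrank_eq_two w (T5GaussianPlace.finrank_eq_two w) w' hw'⟩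

/-- The family has a finite non-split place: `2` has kind `ns`. -/
theorem kindOf_v₂ : kindOf ℚ L (Sum.inl v₂) = PlaceKind.ns :=
  kindOf_eq_ns isNonSplit_v₂

/-- `ℚ` HAS A REAL PLACE (the one of `ℚ ⊆ ℂ`): the real-place clause of the witness is not vacuous. -/
theorem exists_real_place_rat : ∃ τ : NumberField.InfinitePlace ℚ, τ.IsReal := by
  refine ⟨NumberField.InfinitePlace.mk (algebraMap ℚ ℂ), ?_⟩
  rw [NumberField.InfinitePlace.isReal_mk_iff]
  refine RingHom.ext fun x => ?_
  simp

/-- The family has a real place: the kind `re` occurs. -/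
theorem exists_kindOf_eq_re : ∃ x : GlobalIndex ℚ, kindOf ℚ L x = PlaceKind.re :=
  let ⟨τ, hτ⟩ := exists_real_place_rat
  ⟨Sum.inr ⟨τ, hτ⟩, rfl⟩

/-- THE WITNESS: on the places of `ℚ` (finite ⊕ real) there is a sign model with the global kinds relative to
`ℚ(ζ₄)`, the statements of record's local data with the toy three data at every non-split finite place, t6-p7's toy
real data on both sides at the real place, and `Solves ∧ RealCondB` — every hypothesis of
`exists_signModel_ofGlobal` discharged. -/
theorem gaussian_global_witness :
    ∃ S : SignModel (GlobalIndex ℚ), S.kind = kindOf ℚ L ∧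
      S.D = (PlaceFamily.ofGlobal finrank_eq_two toyFamily).D ∧ S.Solves ∧ S.RealCondB :=
  exists_signModel_ofGlobal finrank_eq_two toyFamily toyFamily_hyps (fun _ => Toy.toy) (fun _ => Toy.toy)
    (fun _ => Toy.toy_thm3_5) (fun _ => Toy.toy_thm3_5) (fun _ => Toy.toy_fockDict) (fun _ => Toy.toy_fockDict)
    (fun _ => Toy.toy_halfLine) (fun _ => Toy.toy_halfLine)

end Gaussian

end

end Summit.Ventures.HodgeRepro2.T6.N5LocalSignModelGlobalWitness
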